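import Summits.AtomisticToContinuum.Crystallization.Theorems.ChartedZeroExcessLayeredLatticeLiouvilleZZZYRG

/-!
# ZZZYRGL — height LOCATION about the stress-free curve and the localised two-dimensional door (companion of ZZZYRG, §3)
(decomp-a2c lens-2 «special vs generic», gen 102; binder `ChartedPlanarOrder.ChartedZeroExcessLayered`, line (D))

The LOCATION of a word's height interval is a FREE MODULUS of the unrestricted admissible class (homogeneously strained stacked words are clean and
single-site Nash), so `HLocPIn θ uc` below is FALSE modulo such an inhabitant whenever `θ` is smaller than the band's half-width — it is NOT a
leaf for the door of record.  It becomes meaningful for the STRESS-RESTRICTED class of the pending door edit (planner flag r1816/r1819: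
`IsEquilChart ∧ ‖σ‖ ≤ s₀`): a bound on the transmitted normal stress plus monotonicity of the HOMOGENEOUS normal stress in the gap (equation of
state; instrumentable) localises every word's heights within `θ ≈ s₀ / lam_hom` of the stress-free height curve `uc a`; with ZZZYRG's oscillation
rigidity `HOscPIn ω` the door then asks for cells only in the tolerance neighbourhood `|u − uc a| ≤ θ + ω` of that curve («the JS-D atlas
collapses to tolerance neighbourhoods of the stress-free states», TREE 136J).

Results: `HLocPIn` (def), `loc_of_registeredBH_narrow`, ★ `uniformEquilStabilityAtIn_of_atlasW_hollow_window₂_loc` (ZZZYRG's two-dimensional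
door with the cover restricted to `|u − uc a| ≤ θ + ω`; all other hypotheses verbatim).
0 sorry · no instances / notation / options · import = ZZZYRG. [g102]
-/

noncomputable section

namespace Summit.AtomisticToContinuum.Crystallization.Theorems.ChartedZeroExcessLayeredLatticeLiouville

open scoped BigOperators RealInnerProductSpace
open Summit.AtomisticToContinuum.Crystallization.Theorems.ChartedPlanarOrderRigidityDoor (E3)

variable {ι : Type*}

/-! ## §3 Location (the free modulus) — only for a STRESS-RESTRICTED admissible class -/

/-- **«HLocPIn s Λ c₀ ℓ₀ δ hLoB hHiB θ uc W» — HEIGHT LOCATION** about the curve `uc : ℝ → ℝ` (scale ↦ height ratio): every step height of an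
admissible banded-hollow word at scale `a ∈ W` is within `θ·a` of `uc a · a`.  UNDECIDED; false modulo a strained homogeneous inhabitant for the
unrestricted class (see the section docstring) — a leaf for the stress-restricted class only. [g102] -/
def HLocPIn (s Λ c₀ ℓ₀ δ hLoB hHiB θ : ℝ) (uc : ℝ → ℝ) (W : Set ℝ) : Prop :=
  ∀ a : ℝ, a ∈ W → 0 < a → ∀ (L : E3 ≃L[ℝ] E3) (w' : ℤ → E3), IsAdmissibleWord a s Λ c₀ ℓ₀ L w' →
    IsRegisteredWordBH δ hLoB hHiB a L w' → ∀ n : E3, IsBandNormal hLoB hHiB a L w' n →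
      ∀ m : ℤ, |stepNormal n w' m - uc a * a| ≤ θ * a

/-- a word registered in the narrow band `[u, u + ω] ⊆ [hLoB, hHiB]` whose heights are located within `θ` of `v` has `v − θ − ω ≤ u ≤ v + θ`. [g102] -/
theorem loc_of_registeredBH_narrow {δ hLoB hHiB ω θ v u a : ℝ} {L : E3 ≃L[ℝ] E3} {w' : ℤ → E3} (ha : 0 < a) (hu1 : hLoB ≤ u)
    (hu2 : u + ω ≤ hHiB) (hreg : IsRegisteredWordBH δ u (u + ω) a L w')
    (hloc : ∀ n : E3, IsBandNormal hLoB hHiB a L w' n → ∀ m : ℤ, |stepNormal n w' m - v * a| ≤ θ * a) :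
    v - θ - ω ≤ u ∧ u ≤ v + θ := by
  obtain ⟨ℓ, n, r, h, -, -, hn, hg₁, hg₂, hrh, hstep⟩ := hreg
  have hm : ∀ m : ℤ, ⟪w' (m + 1) - w' m, n⟫ = h m := fun m => by
    rw [hstep m]; exact inner_registeredStep hn hg₁ hg₂ (hrh m).2.1 _ _
  have hbn : IsBandNormal hLoB hHiB a L w' n := ⟨hn, hg₁, hg₂, fun m => by
    rw [hm m]
    exact ⟨(mul_le_mul_of_nonneg_right hu1 ha.le).trans (hrh m).2.2.1,
      (hrh m).2.2.2.trans (mul_le_mul_of_nonneg_right hu2 ha.le)⟩⟩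
  have h1 := hloc n hbn (0 + 1)
  simp only [stepNormal, add_sub_cancel_right] at h1
  rw [hm 0] at h1
  obtain ⟨h1a, h1b⟩ := abs_le.1 h1
  have h2 := (hrh 0).2.2.1
  have h3 := (hrh 0).2.2.2
  constructor
  · have h4 : (v - θ - ω) * a ≤ u * a := by nlinarith
    exact le_of_mul_le_mul_right h4 ha
  · have h4 : u * a ≤ (v + θ) * a := by nlinarith
    exact le_of_mul_le_mul_right h4 ha

/-- ★ THE LOCALISED TWO-DIMENSIONAL DOOR: with height location `HLocPIn θ uc` on top of oscillation rigidity `HOscPIn ω`, cells are needed only at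
`(a, u)` with `|u − uc a| ≤ θ + ω` (and `[u, u + ω] ⊆ [hLoB, hHiB]`).  For the stress-restricted class; all other hypotheses verbatim. [g102] -/
theorem uniformEquilStabilityAtIn_of_atlasW_hollow_window₂_loc {s Λ c₀ ℓ₀ r₁ ϱ R cZ κ₁ κ₀ γT δ hLoB hHiB amin amax ω θ : ℝ}
    {uc : ℝ → ℝ} {W : Set ℝ}
    {aLo aHi τ hLo hHi c cK : ι → ℝ} {ΘR ΘN : ι → (E3 ≃L[ℝ] E3) → (ℤ → E3) → (Cell 2 × ℤ) × (Cell 2 × ℤ) → ℝ}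
    (h0 : 0 ≤ κ₁) (hκ : κ₀ ≤ κ₁ * cZ - γT) (hRI : UniformReindexPCIn s Λ c₀ ℓ₀ (IsRegisteredWord δ) W)
    (hHB : HBandP s Λ c₀ ℓ₀ hLoB hHiB) (hHol : HollowP s Λ c₀ ℓ₀ δ) (hcK0 : ∀ i, 0 ≤ cK i) (hcK : ∀ i, cK i * c i ≤ 1)
    (hCS : CellSumP s Λ c₀ ℓ₀ r₁) (hNC : CellNullLagrangianP s Λ c₀ ℓ₀ r₁) (hW : W ⊆ Set.Icc amin amax)
    (hωB : hLoB + ω ≤ hHiB) (hHO : HOscPIn s Λ c₀ ℓ₀ δ hLoB hHiB ω W) (hHL : HLocPIn s Λ c₀ ℓ₀ δ hLoB hHiB θ uc W)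
    (hcover : ∀ a : ℝ, amin ≤ a → a ≤ amax → ∀ u : ℝ, hLoB ≤ u → u + ω ≤ hHiB → uc a - θ - ω ≤ u → u ≤ uc a + θ →
      ∃ i, aLo i ≤ a ∧ a ≤ aHi i ∧ δ ≤ τ i ∧ hLo i ≤ u ∧ u + ω ≤ hHi i)
    (hcell : ∀ i, BoxCellCertificateP s Λ c₀ ℓ₀ r₁ (InBoxWH s (aLo i) (aHi i) (τ i) (hLo i) (hHi i)) (c i))
    (htail : ∀ i, BoxTailDebitP s Λ c₀ ℓ₀ ϱ (InBoxWH s (aLo i) (aHi i) (τ i) (hLo i) (hHi i)) (ΘR i) (ΘN i) γT)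
    (hPU : PartitionIdentityFullP s Λ c₀ ℓ₀ r₁ ϱ R) (hPD : PartitionIdentityDebitP s Λ c₀ ℓ₀ ϱ R)
    (hclus : ∀ i, BoxClusterCertificateDebitP s Λ c₀ ℓ₀ r₁ ϱ R (InBoxWH s (aLo i) (aHi i) (τ i) (hLo i) (hHi i)) (cK i) (ΘR i) (ΘN i) κ₁)
    (hCZ : IndexCurrencyP s Λ c₀ ℓ₀ r₁ cZ) : UniformEquilStabilityAtIn s Λ κ₀ c₀ W := by
  refine uniformEquilStabilityAtIn_of_atlasC h0 hκ (uniformReindexPCIn_window (uniformReindexPCIn_bandedHollow hRI hHB hHol))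
    hcK0 hcK hCS hNC ?_ hcell htail hPU hPD hclus hCZ
  intro a ha L w' hA hreg
  obtain ⟨u, hu1, hu2, hregu⟩ :=
    isRegisteredWordBH_narrow ha hωB hreg.1 fun n hn m m' => hHO a hreg.2 ha L w' hA hreg.1 n hn m m'
  obtain ⟨hl1, hl2⟩ :=
    loc_of_registeredBH_narrow ha hu1 hu2 hregu fun n hn m => hHL a hreg.2 ha L w' hA hreg.1 n hn m
  obtain ⟨i, haLo, haHi, hτ, hlo, hhi⟩ := hcover a (hW hreg.2).1 (hW hreg.2).2 u hu1 hu2 hl1 hl2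
  exact ⟨i, inBoxWH_of_registeredBH ha.le hA hregu haLo haHi hτ hlo hhi⟩

end Summit.AtomisticToContinuum.Crystallization.Theorems.ChartedZeroExcessLayeredLatticeLiouville

end
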